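import Summits.ABC.ABC.Theorems.TwistAmplificationMazurKaneLawDERoots
import Literature.NumberTheory.DiophantineGeometry.AbcShapeSubBox
import Literature.NumberTheory.DiophantineGeometry.AbcShapeGeometrySets

-- Summit.ABC.ABC is the mandated summit-side namespace (single-conjunct summit); the lakefile sets the same option tree-wide.
set_option linter.dupNamespace false

/-!
# Fibres of the DE tool: the number of roots per base, and lattices with a short vector (crux stmt-ABC-2757, stubs `de_card_fibres_le` and `de_card_short_le`)

Two counting pieces of the "DE tool" for the line `critical-kloosterman-powerful-moduli` of the crux
`Summit.ABC.ABC.Theses.TwistAmplification.MazurKaneLaw`.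

Notation.  Host box `X` with level set `Q` (host tuples `r ∈ subBox Qᶜ X`, modulus
`q(r) := W_Q(r) = ∏_{i∈Q} rᵢ^{i+1}` = `AbcShapes.onVal Q r`), side boxes `Y, Z`,
`CP := subBox {i₀,i₁} Y × subBox {i₀,i₁} Z`, `F(Cp) := c₂·offVal {i₀,i₁} Cp.1 · (c₃·offVal {i₀,i₁} Cp.2)`.
The fibre set `ΦL` consists of the `φ = ((r, (Cp, Dp)), l)` with `l < q(r)`, `gcd(q(r), F(Cp)) =
gcd(q(r), F(Dp)) = 1` and `q(r) ∣ l² F(Cp) − F(Dp)` (so `l` lifts a square root of `F(Dp)/F(Cp)`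
modulo `q(r)`).  Throughout `X` is positive, `W_Q(2X) ≤ T` and `τ(m) ≤ Dτ` for `0 < m ≤ T`.

* `de_card_rootSet_le` (root count): for fixed `(r, Cp, Dp)` the admissible `l` number at most
  `Dτ³`: `l ↦ (l : ZMod q)` injects them into the solutions of `λ² F(Cp) = F(Dp)` in `ZMod q`, which
  are at most the square roots of unity (`de_card_roots_le`), at most `τ(q)³ ≤ Dτ³` of them
  (`natCard_rootsOfUnity_le_pow`).
* `de_card_fibres_le` (stub "number of fibres"): `#ΦL ≤ #subBox Qᶜ X · (#subBox Y · #subBox Z)² · Dτ³`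
  (`Finset.card_le_mul_card_image` over the projection `φ ↦ (r, (Cp, Dp))`).
* `de_card_short_le` (stub "lattices with a short vector are few"): the `φ ∈ ΦL` whose lattice
  `a ≡ l b (mod q(r))` has a nonzero vector `(a, b)` of sup-norm `≤ 2^k` number at most
  `Dτ³ · #Gset(2^k)`, where `Gset(L)` is the set of `(r, ((a, Cp), (b, Dp)))`, `|a|, |b| ≤ L`,
  `(a, b) ≠ 0`, with `q(r) ∣ a² F(Cp) − b² F(Dp)`: double counting along the relation
  "`w = (r, ((a, Cp), (b, Dp)))` for some `a, b`" — every short `φ` is related to the point of `Gset`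
  given by its short vector (`a ≡ l b ⇒ a² F(Cp) ≡ l² b² F(Cp) ≡ b² F(Dp)`), and every `w ∈ Gset` is
  related to at most `Dτ³` fibres (they differ only in the root `l`).

No new definitions; everything here is folklore bookkeeping.
-/

namespace Summit.ABC.ABC.Theorems.MazurKaneLaw

open Finset
open Literature.NumberTheory.DiophantineGeometry
open Literature.NumberTheory.DiophantineGeometry.AbcShapes

/-! ### Generic counting helpers -/

/-- Double counting with a relation: if every `a ∈ s` is related to some `b ∈ t`, and every `b ∈ t`
is related to at most `n` elements of `s`, then `#s ≤ n · #t` (`Finset.card_mul_le_card_mul`).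
[folklore] -/
theorem de_card_le_mul_card_of_rel {α β : Type*} (r : α → β → Prop) [∀ a b, Decidable (r a b)]
    {s : Finset α} {t : Finset β} {n : ℕ} (hm : ∀ a ∈ s, ∃ b ∈ t, r a b)
    (hn : ∀ b ∈ t, (s.bipartiteBelow r b).card ≤ n) : s.card ≤ n * t.card := by
  calc s.card = s.card * 1 := (Nat.mul_one _).symm
    _ ≤ t.card * n := Finset.card_mul_le_card_mul r (fun a ha => ?_) hn
    _ = n * t.card := Nat.mul_comm _ _
  obtain ⟨b, hb, hab⟩ := hm a ha
  exact Finset.one_le_card.mpr ⟨b, (Finset.mem_bipartiteAbove r).mpr ⟨hb, hab⟩⟩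

/-- The algebra behind "short vector ⇒ square congruence": if `q ∣ a − l b` and `q ∣ l² C − D` then
`q ∣ a² C − b² D`, since `a² C − b² D = (a − l b)(a + l b) C + b² (l² C − D)`. [folklore] -/
theorem de_dvd_sq_sub_sq {q a b l C D : ℤ} (h1 : q ∣ a - l * b) (h2 : q ∣ l ^ 2 * C - D) :
    q ∣ a ^ 2 * C - b ^ 2 * D := by
  have e : a ^ 2 * C - b ^ 2 * D = (a - l * b) * ((a + l * b) * C) + b ^ 2 * (l ^ 2 * C - D) := by
    ring
  rw [e]
  exact dvd_add (Dvd.dvd.mul_right h1 _) (Dvd.dvd.mul_left h2 _)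

/-- The modulus `q(r) = W_Q(r)` of a host tuple `r ∈ subBox Qᶜ X` (positive box) is nonzero and at
most `W_Q(2X)` (`Xᵢ ≤ rᵢ ≤ 2Xᵢ` coordinatewise, `AbcShapes.onVal_mono`). [folklore] -/
theorem de_onVal_ne_zero_and_le {d : ℕ} {Q : Finset (Fin d)} {X r : Fin d → ℕ} (hX : ∀ j, 0 < X j)
    (hr : r ∈ subBox Qᶜ X) : onVal Q r ≠ 0 ∧ onVal Q r ≤ onVal Q (fun j => 2 * X j) := by
  rw [mem_subBox] at hr
  have hb : ∀ i, X i ≤ r i ∧ r i ≤ 2 * X i := by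
    intro i
    by_cases hi : i ∈ Qᶜ
    · rw [(hr i).1 hi]; have := hX i; omega
    · have := (hr i).2 hi; omega
  have hpos : 0 < onVal Q r := by
    show 0 < ∏ i ∈ Q, r i ^ ((i : ℕ) + 1)
    exact Finset.prod_pos fun i _ => pow_pos (lt_of_lt_of_le (hX i) (hb i).1) _
  exact ⟨hpos.ne', onVal_mono Q fun i => (hb i).2⟩

/-- **Root count.**  Let `q ≠ 0`, `q ≤ T`, `τ(m) ≤ Dτ` for `0 < m ≤ T`, and let `s` be a finite set
with a map `g` to `ℕ`, injective on `s`, such that for every `a ∈ s`: `g a < q`,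
`gcd(q, F_C) = gcd(q, F_D) = 1` and `q ∣ (g a)² F_C − F_D`.  Then `#s ≤ Dτ³`: `a ↦ (g a : ZMod q)`
injects `s` into the solutions of `λ² F_C = F_D` in `ZMod q` (`F_C, F_D` units), which are at most
the square roots of unity (`de_card_roots_le`), at most `τ(q)³ ≤ Dτ³` of them
(`natCard_rootsOfUnity_le_pow`). [folklore] -/
theorem de_card_rootSet_le {α : Type*} {q T Dτ FC FD : ℕ} (hq : q ≠ 0) (hqT : q ≤ T)
    (hD : ∀ m : ℕ, m ≠ 0 → m ≤ T → m.divisors.card ≤ Dτ) (s : Finset α) (g : α → ℕ)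
    (hg : Set.InjOn g s)
    (hs : ∀ a ∈ s, g a < q ∧ Nat.Coprime q FC ∧ Nat.Coprime q FD ∧
      (q : ℤ) ∣ ((g a ^ 2 * FC : ℕ) : ℤ) - ((FD : ℕ) : ℤ)) :
    s.card ≤ Dτ ^ 3 := by
  rcases s.eq_empty_or_nonempty with rfl | ⟨a₀, ha₀⟩
  · rw [card_empty]; exact Nat.zero_le _
  obtain ⟨-, hC, hDc, -⟩ := hs a₀ ha₀
  haveI : NeZero q := ⟨hq⟩
  have hCu : IsUnit ((FC : ℕ) : ZMod q) := (ZMod.isUnit_iff_coprime FC q).mpr hC.symm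
  have hDu : IsUnit ((FD : ℕ) : ZMod q) := (ZMod.isUnit_iff_coprime FD q).mpr hDc.symm
  calc s.card ≤ (Finset.univ.filter (fun lam : ZMod q => lam ^ 2 * (FC : ZMod q) = (FD : ZMod q))).card := by
        refine card_le_card_of_injOn (fun a => ((g a : ℕ) : ZMod q)) (fun a ha => ?_)
          (fun a ha a' ha' h => ?_)
        · obtain ⟨-, -, -, hdvd⟩ := hs a (mem_coe.mp ha)
          have h0 := (ZMod.intCast_zmod_eq_zero_iff_dvd _ q).mpr hdvd
          push_cast at h0
          exact mem_coe.mpr (mem_filter.mpr ⟨mem_univ _, sub_eq_zero.mp h0⟩)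
        · have h' : ((g a : ℕ) : ZMod q).val = ((g a' : ℕ) : ZMod q).val := congrArg ZMod.val h
          rw [ZMod.val_cast_of_lt (hs a (mem_coe.mp ha)).1,
            ZMod.val_cast_of_lt (hs a' (mem_coe.mp ha')).1] at h'
          exact hg ha ha' h'
    _ ≤ Nat.card {ρ : ZMod q // ρ ^ 2 = 1} := de_card_roots_le q _ _ hCu hDu
    _ ≤ Dτ ^ 3 := natCard_rootsOfUnity_le_pow (n := 1) hq (hD q hq hqT)

/-! ### The two stubs -/

/-- **Number of fibres** (stub `de_card_fibres_le` of the DE tool, line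
`critical-kloosterman-powerful-moduli`): with the notation of the module docstring,
`#ΦL ≤ #subBox Qᶜ X · (#subBox {i₀,i₁} Y · #subBox {i₀,i₁} Z)² · Dτ³`.
Proof: project `φ = ((r, (Cp, Dp)), l) ↦ (r, (Cp, Dp))`; on a fibre `φ ↦ l` is injective with values
among the roots of `l² F(Cp) ≡ F(Dp) (mod q(r))`, `l < q(r)`, at most `Dτ³` of them
(`de_card_rootSet_le`, using `0 < q(r) ≤ W_Q(2X) ≤ T`); conclude with
`Finset.card_le_mul_card_image` and `#(A × ((B × C) × (B × C))) = #A (#B #C)²`. [folklore] -/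
theorem de_card_fibres_le : ∀ {d : ℕ} (i₀ i₁ : Fin d) (c₂ c₃ : ℕ) (X Y Z : Fin d → ℕ) (Q : Finset (Fin d)) {T Dτ : ℕ}, (∀ j, 0 < X j) → onVal Q (fun j => 2 * X j) ≤ T → (∀ m : ℕ, m ≠ 0 → m ≤ T → m.divisors.card ≤ Dτ) → (((subBox Qᶜ X ×ˢ ((subBox ({i₀, i₁} : Finset (Fin d)) Y ×ˢ subBox ({i₀, i₁} : Finset (Fin d)) Z) ×ˢ (subBox ({i₀, i₁} : Finset (Fin d)) Y ×ˢ subBox ({i₀, i₁} : Finset (Fin d)) Z))) ×ˢ Finset.range (onVal Q (fun j => 2 * X j))).filter (fun φ : ((Fin d → ℕ) × (((Fin d → ℕ) × (Fin d → ℕ)) × ((Fin d → ℕ) × (Fin d → ℕ)))) × ℕ => φ.2 < onVal Q φ.1.1 ∧ Nat.Coprime (onVal Q φ.1.1) (c₂ * offVal ({i₀, i₁} : Finset (Fin d)) φ.1.2.1.1 * (c₃ * offVal ({i₀, i₁} : Finset (Fin d)) φ.1.2.1.2)) ∧ Nat.Coprime (onVal Q φ.1.1) (c₂ * offVal ({i₀,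 i₁} : Finset (Fin d)) φ.1.2.2.1 * (c₃ * offVal ({i₀, i₁} : Finset (Fin d)) φ.1.2.2.2)) ∧ ((onVal Q φ.1.1 : ℕ) : ℤ) ∣ ((φ.2 ^ 2 * (c₂ * offVal ({i₀, i₁} : Finset (Fin d)) φ.1.2.1.1 * (c₃ * offVal ({i₀, i₁} : Finset (Fin d)) φ.1.2.1.2)) : ℕ) : ℤ) - (((c₂ * offVal ({i₀, i₁} : Finset (Fin d)) φ.1.2.2.1 * (c₃ * offVal ({i₀, i₁} : Finset (Fin d)) φ.1.2.2.2)) : ℕ) : ℤ))).card ≤ (subBox Qᶜ X).card * ((subBox ({i₀, i₁} : Finset (Fin d)) Y).card * (subBox ({i₀, i₁} : Finset (Fin d)) Z).card) ^ 2 * Dτ ^ 3 := by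
  intro d i₀ i₁ c₂ c₃ X Y Z Q T Dτ hX hT hD
  refine (card_le_mul_card_image (f := Prod.fst) _ (Dτ ^ 3) fun w hw => ?_).trans ?_
  · -- the fibre over `w = (r, (Cp, Dp))` injects by `φ ↦ l` into the roots modulo `q(r)`
    obtain ⟨φ₀, hφ₀, rfl⟩ := mem_image.mp hw
    obtain ⟨hq0, hqX⟩ := de_onVal_ne_zero_and_le hX
      (mem_product.mp (mem_product.mp (mem_filter.mp hφ₀).1).1).1
    refine de_card_rootSet_le
      (FC := c₂ * offVal {i₀, i₁} φ₀.1.2.1.1 * (c₃ * offVal {i₀, i₁} φ₀.1.2.1.2))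
      (FD := c₂ * offVal {i₀, i₁} φ₀.1.2.2.1 * (c₃ * offVal {i₀, i₁} φ₀.1.2.2.2))
      hq0 (hqX.trans hT) hD _ (fun φ => φ.2) (fun φ hφ φ' hφ' h => ?_) (fun φ hφ => ?_)
    · have e := (mem_filter.mp (mem_coe.mp hφ)).2
      have e' := (mem_filter.mp (mem_coe.mp hφ')).2
      exact Prod.ext (e.trans e'.symm) h
    · obtain ⟨hφL, e⟩ := mem_filter.mp hφ
      rw [← e]
      exact (mem_filter.mp hφL).2
  · -- the image lies in the base box
    refine (Nat.mul_le_mul_left _ (card_le_card (t := subBox Qᶜ X ×ˢ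
      ((subBox {i₀, i₁} Y ×ˢ subBox {i₀, i₁} Z) ×ˢ (subBox {i₀, i₁} Y ×ˢ subBox {i₀, i₁} Z)))
      fun w hw => ?_)).trans (le_of_eq ?_)
    · obtain ⟨φ, hφ, rfl⟩ := mem_image.mp hw
      exact (mem_product.mp (mem_filter.mp hφ).1).1
    · simp only [card_product]
      ring

/-- **Lattices with a short vector are few** (stub `de_card_short_le` of the DE tool, line
`critical-kloosterman-powerful-moduli`): with the notation of the module docstring, for every `k`
the `φ = ((r, (Cp, Dp)), l) ∈ ΦL` admitting `(a, b) ≠ (0, 0)` with `|a|, |b| ≤ 2^k` and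
`q(r) ∣ a − l b` number at most `Dτ³ · #Gset(2^k)`.
Proof: double counting (`de_card_le_mul_card_of_rel`) along the relation
`φ ~ w :⇔ (r, Cp, Dp)(φ) = (r, Cp, Dp)(w)`: a short `φ` with vector `(a, b)` is related to
`w = (r, ((a, Cp), (b, Dp))) ∈ Gset(2^k)` (`q(r) ∣ a² F(Cp) − b² F(Dp)` by `de_dvd_sq_sub_sq`), and the
`φ` related to a fixed `w` differ only in `l`, a root of `l² F(Cp) ≡ F(Dp)` below `q(r)`: at most
`Dτ³` of them (`de_card_rootSet_le`). [folklore] -/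
theorem de_card_short_le : ∀ {d : ℕ} (i₀ i₁ : Fin d) (c₂ c₃ : ℕ) (X Y Z : Fin d → ℕ) (Q : Finset (Fin d)) (k : ℕ) {T Dτ : ℕ}, (∀ j, 0 < X j) → onVal Q (fun j => 2 * X j) ≤ T → (∀ m : ℕ, m ≠ 0 → m ≤ T → m.divisors.card ≤ Dτ) → ((((subBox Qᶜ X ×ˢ ((subBox ({i₀, i₁} : Finset (Fin d)) Y ×ˢ subBox ({i₀, i₁} : Finset (Fin d)) Z) ×ˢ (subBox ({i₀, i₁} : Finset (Fin d)) Y ×ˢ subBox ({i₀, i₁} : Finset (Fin d)) Z))) ×ˢ Finset.range (onVal Q (fun j => 2 * X j))).filter (fun φ : ((Fin d → ℕ) × (((Fin d → ℕ) × (Fin d → ℕ)) × ((Fin d → ℕ) × (Fin d → ℕ)))) × ℕ => φ.2 < onVal Q φ.1.1 ∧ Nat.Coprime (onVal Q φ.1.1) (c₂ * offVal ({i₀, i₁} : Finset (Fin d)) φ.1.2.1.1 * (c₃ * offVal ({i₀, i₁} : Finset (Fin d)) φ.1.2.1.2)) ∧ Nat.Coprime (onVal Q φ.1.1) (c₂ *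 offVal ({i₀, i₁} : Finset (Fin d)) φ.1.2.2.1 * (c₃ * offVal ({i₀, i₁} : Finset (Fin d)) φ.1.2.2.2)) ∧ ((onVal Q φ.1.1 : ℕ) : ℤ) ∣ ((φ.2 ^ 2 * (c₂ * offVal ({i₀, i₁} : Finset (Fin d)) φ.1.2.1.1 * (c₃ * offVal ({i₀, i₁} : Finset (Fin d)) φ.1.2.1.2)) : ℕ) : ℤ) - (((c₂ * offVal ({i₀, i₁} : Finset (Fin d)) φ.1.2.2.1 * (c₃ * offVal ({i₀, i₁} : Finset (Fin d)) φ.1.2.2.2)) : ℕ) : ℤ))).filter (fun φ : ((Fin d → ℕ) × (((Fin d → ℕ) × (Fin d → ℕ)) × ((Fin d → ℕ) × (Fin d → ℕ)))) × ℕ => ∃ a ∈ Finset.Icc (-((2 : ℤ) ^ k)) ((2 : ℤ) ^ k), ∃ b ∈ Finset.Icc (-((2 : ℤ) ^ k)) ((2 : ℤ) ^ k), (a, b) ≠ (0, 0) ∧ ((onVal Q φ.1.1 : ℕ) : ℤ) ∣ a - (φ.2 : ℤ) * b)).card ≤ Dτ ^ 3 * (((subBox Qᶜ X ×ˢ ((Finset.Icc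 (-(((2 : ℕ) ^ k : ℕ) : ℤ)) ((2 : ℕ) ^ k : ℕ) ×ˢ (subBox ({i₀, i₁} : Finset (Fin d)) Y ×ˢ subBox ({i₀, i₁} : Finset (Fin d)) Z)) ×ˢ (Finset.Icc (-(((2 : ℕ) ^ k : ℕ) : ℤ)) ((2 : ℕ) ^ k : ℕ) ×ˢ (subBox ({i₀, i₁} : Finset (Fin d)) Y ×ˢ subBox ({i₀, i₁} : Finset (Fin d)) Z)))).filter (fun w : (Fin d → ℕ) × ((ℤ × ((Fin d → ℕ) × (Fin d → ℕ))) × (ℤ × ((Fin d → ℕ) × (Fin d → ℕ)))) => (w.2.1.1, w.2.2.1) ≠ (0, 0) ∧ ((onVal Q w.1 : ℕ) : ℤ) ∣ ((w.2.1.1 ^ 2 * ((c₂ * offVal ({i₀, i₁} : Finset (Fin d)) w.2.1.2.1 * (c₃ * offVal ({i₀, i₁} : Finset (Fin d)) w.2.1.2.2)) : ℕ) : ℤ) - (w.2.2.1 ^ 2 * ((c₂ * offVal ({i₀, i₁} : Finset (Fin d)) w.2.2.2.1 * (c₃ * offVal ({i₀, i₁} : Finset (Fin d)) w.2.2.2.2))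 : ℕ) : ℤ))))).card := by
  intro d i₀ i₁ c₂ c₃ X Y Z Q k T Dτ hX hT hD
  classical
  refine de_card_le_mul_card_of_rel
    (fun (φ : ((Fin d → ℕ) × (((Fin d → ℕ) × (Fin d → ℕ)) × ((Fin d → ℕ) × (Fin d → ℕ)))) × ℕ)
      (w : (Fin d → ℕ) × ((ℤ × ((Fin d → ℕ) × (Fin d → ℕ))) × (ℤ × ((Fin d → ℕ) × (Fin d → ℕ))))) =>
      φ.1.1 = w.1 ∧ φ.1.2.1 = w.2.1.2 ∧ φ.1.2.2 = w.2.2.2)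
    (fun φ hφ => ?_) (fun w hw => ?_)
  · -- a short fibre `φ` with short vector `(a, b)` is related to `(r, ((a, Cp), (b, Dp))) ∈ Gset`
    obtain ⟨hφL, a, ha, b, hb, hab, hdvd⟩ := mem_filter.mp hφ
    obtain ⟨hbox, -, -, -, hroot⟩ := mem_filter.mp hφL
    obtain ⟨hr, hCD⟩ := mem_product.mp (mem_product.mp hbox).1
    obtain ⟨hCp, hDp⟩ := mem_product.mp hCD
    refine ⟨(φ.1.1, ((a, φ.1.2.1), (b, φ.1.2.2))), mem_filter.mpr ⟨?_, hab, ?_⟩, rfl, rfl, rfl⟩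
    · refine mem_product.mpr ⟨hr, mem_product.mpr ⟨mem_product.mpr ⟨?_, hCp⟩,
        mem_product.mpr ⟨?_, hDp⟩⟩⟩
      · push_cast; exact ha
      · push_cast; exact hb
    · push_cast at hroot ⊢
      exact de_dvd_sq_sub_sq hdvd hroot
  · -- the fibres related to `w` differ only in the root `l`
    obtain ⟨hq0, hqX⟩ := de_onVal_ne_zero_and_le hX (mem_product.mp (mem_filter.mp hw).1).1
    refine de_card_rootSet_le
      (FC := c₂ * offVal {i₀, i₁} w.2.1.2.1 * (c₃ * offVal {i₀, i₁} w.2.1.2.2))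
      (FD := c₂ * offVal {i₀, i₁} w.2.2.2.1 * (c₃ * offVal {i₀, i₁} w.2.2.2.2))
      hq0 (hqX.trans hT) hD _ (fun φ => φ.2) (fun φ hφ φ' hφ' h => ?_) (fun φ hφ => ?_)
    · obtain ⟨-, e1, e2, e3⟩ := (mem_bipartiteBelow _).mp (mem_coe.mp hφ)
      obtain ⟨-, e1', e2', e3'⟩ := (mem_bipartiteBelow _).mp (mem_coe.mp hφ')
      exact Prod.ext (Prod.ext (e1.trans e1'.symm)
        (Prod.ext (e2.trans e2'.symm) (e3.trans e3'.symm))) h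
    · obtain ⟨hSh, e1, e2, e3⟩ := (mem_bipartiteBelow _).mp hφ
      rw [← e1, ← e2, ← e3]
      exact (mem_filter.mp (mem_filter.mp hSh).1).2

end Summit.ABC.ABC.Theorems.MazurKaneLaw
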